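/-
Copyright: b2b-lace packet (tail-bound analyst, gen 2). Kernel PCM, part A (LEMMAS N43a): the SRW
transition function `p_i(y)` in Fourier form, its one-step recursion, sign symmetry, and the
reflection inequality (M4) `p_i(x + e_μ) ≤ p_i(x - e_μ)` for `x_μ ≥ 0`, proved by induction on `i`
from the recursion alone; hence parity-class monotonicity of every `p_i`.
-/
import Literature.Probability.FitznerVanDerHofstad2017.SrwIntegralParityDomination
import Literature.Barriers.CriticalPhenomena.GaussianDominationRouteFourierInversion
import HarnessLib

/-!
# The SRW transition function: recursion, reflection symmetry, and the reflection inequality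

`srwP d i y = (2π)^{-d} ∫_{[-π,π]^d} D̂(k)^i cos(k·y) dk` is the `i`-step transition probability
`p_i(y) = D^{*i}(y)` of simple random walk on `ℤ^d` ([HS92b] (1.1); [FvdH17-NoBLE] §3.4).  We never
use the walk: everything follows from `p_0 = δ_0` (orthogonality of the cosines on the cube, tree
theorem `integral_cube_cos_kdot_mul_cos_kdot`) and the recursion
`p_{i+1}(y) = (2d)^{-1} Σ_ν [p_i(y + e_ν) + p_i(y - e_ν)]` (product-to-sum under the integral).

* `srwP_coordNeg`: `p_i` is invariant under `y_μ ↦ -y_μ`.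
* `srwP_step_le` **(M4)**: `p_i(x + e_μ) ≤ p_i(x - e_μ)` whenever `x_μ ≥ 0` (carver-g6 LEMMA-M.md
  (M4) = tail-g2 KSUP.md §9.1a; the recursion-only induction).
* `parityMonotone_of_step_reflect`: a function that decreases under the parity-preserving steps
  `y ↦ y + 2e_μ` (`y_μ ≥ -1`) and is sign-symmetric is parity-class monotone.
* `parityMonotone_srwP`: every `p_i` is parity-class monotone.
-/

namespace Literature.Probability.FitznerVanDerHofstad2017

open MeasureTheory Real Finset Filter Topology
open scoped BigOperators
open Literature.Barriers.CriticalPhenomena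
open Literature.Barriers.CriticalPhenomena.Slade2006Prop53 (P)
open Literature.Probability.LatticeModels

variable {d : ℕ}

/-! ### Definition and integrability -/

/-- `p_i(y) = (2π)^{-d} ∫ D̂(k)^i cos(k·y) dk`, the `i`-step SRW transition function in Fourier form.
[cite: FitznerVanDerHofstad2016NoBLE, §3.4 p. 1071] -/
noncomputable def srwP (d i : ℕ) (y : Fin d → ℤ) : ℝ :=
  (∫ k, Dhat d k ^ i * Real.cos (kdot k y) ∂P d) / (2 * π) ^ d

/-- The integrand of `p_i` is integrable on the cube (continuous, bounded by `1`). [folklore] -/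
theorem integrable_Dhat_pow_mul_cos (i : ℕ) (y : Fin d → ℤ) :
    Integrable (fun k => Dhat d k ^ i * Real.cos (kdot k y)) (P d) := by
  refine (integrable_const (1 : ℝ)).mono' ?_ (ae_of_all _ fun k => ?_)
  · exact (((continuous_Dhat d).pow i).mul (continuous_cos_kdot y)).aestronglyMeasurable
  · rw [Real.norm_eq_abs, abs_mul, abs_pow]
    exact mul_le_one₀ (pow_le_one₀ (abs_nonneg _) (abs_Dhat_le_one k)) (abs_nonneg _)
      (Real.abs_cos_le_one _)

/-! ### `p_0 = δ_0` -/

/-- `p_0(y) = 𝟙{y = 0}` (orthogonality of the cosines on the cube).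
[cite: HeydenreichVanDerHofstad2017, (1.2.17)] -/
theorem srwP_zero (y : Fin d → ℤ) : srwP d 0 y = if y = 0 then 1 else 0 := by
  unfold srwP
  have h := integral_cube_cos_kdot_mul_cos_kdot (0 : Site d) y
  rw [volume_restrict_cube_eq_P] at h
  simp only [kdot_zero_right, Real.cos_zero, one_mul, zero_add] at h
  simp only [pow_zero, one_mul]
  rw [h]
  have hpi : (0 : ℝ) < (2 * π) ^ d := by positivity
  by_cases hy : y = 0
  · subst hy
    simp only [if_true]
    field_simp
    ring
  · rw [if_neg hy, if_neg (fun h => hy h.symm)]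
    ring

/-! ### The one-step recursion -/

/-- `k·(y + a e_j) = k·y + a k_j`. [folklore] -/
theorem kdot_add_axisVec (k : Fin d → ℝ) (y : Fin d → ℤ) (j : Fin d) (a : ℤ) :
    kdot k (y + axisVec j a) = kdot k y + a * k j := by
  unfold kdot axisVec
  simp only [Pi.add_apply, Int.cast_add, mul_add, Finset.sum_add_distrib]
  congr 1
  rw [Finset.sum_eq_single j]
  · simp only [if_true]; ring
  · intro m _ hm
    simp [hm]
  · intro h
    exact absurd (Finset.mem_univ j) h

/-- `k·(y - a e_j) = k·y - a k_j`. [folklore] -/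
theorem kdot_sub_axisVec (k : Fin d → ℝ) (y : Fin d → ℤ) (j : Fin d) (a : ℤ) :
    kdot k (y - axisVec j a) = kdot k y - a * k j := by
  have h : y - axisVec j a = y + axisVec j (-a) := by
    funext m
    simp only [Pi.sub_apply, Pi.add_apply, axisVec]
    split_ifs <;> ring
  rw [h, kdot_add_axisVec]
  push_cast
  ring

/-- Product-to-sum under `D̂`: `D̂(k) cos(k·y) = (2d)^{-1} Σ_j [cos(k·(y + e_j)) + cos(k·(y - e_j))]`.
[folklore] -/
theorem Dhat_mul_cos_kdot (k : Fin d → ℝ) (y : Fin d → ℤ) :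
    Dhat d k * Real.cos (kdot k y) =
      (∑ j, (Real.cos (kdot k (y + axisVec j 1)) + Real.cos (kdot k (y - axisVec j 1)))) /
        (2 * d) := by
  have hj : ∀ j, Real.cos (kdot k (y + axisVec j 1)) + Real.cos (kdot k (y - axisVec j 1)) =
      2 * (Real.cos (k j) * Real.cos (kdot k y)) := by
    intro j
    rw [kdot_add_axisVec, kdot_sub_axisVec, Int.cast_one, one_mul, cos_mul_cos_eq,
      add_comm (k j) (kdot k y), show k j - kdot k y = -(kdot k y - k j) by ring, Real.cos_neg]
    ring
  simp_rw [hj]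
  rw [← Finset.mul_sum, ← Finset.sum_mul, Dhat_def]
  rcases Nat.eq_zero_or_pos d with hd | hd
  · subst hd
    simp
  · have hd' : (0 : ℝ) < d := by exact_mod_cast hd
    field_simp

/-- **Recursion**: `p_{i+1}(y) = (2d)^{-1} Σ_j [p_i(y + e_j) + p_i(y - e_j)]`.
[cite: FitznerVanDerHofstad2016NoBLE, §3.4 p. 1071] -/
theorem srwP_succ (i : ℕ) (y : Fin d → ℤ) :
    srwP d (i + 1) y =
      (∑ j, (srwP d i (y + axisVec j 1) + srwP d i (y - axisVec j 1))) / (2 * d) := by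
  unfold srwP
  have hpt : ∀ k, Dhat d k ^ (i + 1) * Real.cos (kdot k y) =
      (∑ j, (Dhat d k ^ i * Real.cos (kdot k (y + axisVec j 1)) +
        Dhat d k ^ i * Real.cos (kdot k (y - axisVec j 1)))) / (2 * d) := by
    intro k
    rw [pow_succ, mul_assoc, Dhat_mul_cos_kdot, mul_div_assoc', Finset.mul_sum]
    simp only [mul_add]
  simp_rw [hpt]
  rw [integral_div, integral_finsetSum _ (fun j _ => ?_)]
  swap
  · exact (integrable_Dhat_pow_mul_cos i _).add (integrable_Dhat_pow_mul_cos i _)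
  simp_rw [integral_add (integrable_Dhat_pow_mul_cos i _) (integrable_Dhat_pow_mul_cos i _)]
  rw [div_right_comm, Finset.sum_div]
  simp_rw [add_div]

/-! ### Sign symmetry -/

/-- Negate the `μ`-th coordinate. [folklore] -/
def coordNeg (μ : Fin d) (y : Fin d → ℤ) : Fin d → ℤ := fun j => if j = μ then -y j else y j

/-- `coordNeg μ y = 0 ↔ y = 0`. [folklore] -/
theorem coordNeg_eq_zero_iff (μ : Fin d) (y : Fin d → ℤ) : coordNeg μ y = 0 ↔ y = 0 := by
  constructor
  · intro h
    funext j
    have hj := congr_fun h j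
    simp only [coordNeg, Pi.zero_apply] at hj
    split_ifs at hj
    · simpa using hj
    · exact hj
  · intro h
    subst h
    funext j
    simp [coordNeg]

/-- `coordNeg` commutes with the steps `± e_ν`, `ν ≠ μ`. [folklore] -/
theorem coordNeg_add_axisVec_ne {μ ν : Fin d} (h : ν ≠ μ) (y : Fin d → ℤ) (a : ℤ) :
    coordNeg μ (y + axisVec ν a) = coordNeg μ y + axisVec ν a := by
  funext j
  simp only [coordNeg, axisVec, Pi.add_apply]
  by_cases hj : j = μ
  · subst hj
    simp [h.symm]
  · simp [hj]

/-- `coordNeg` turns the step `+a e_μ` into `-a e_μ`. [folklore] -/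
theorem coordNeg_add_axisVec_self (μ : Fin d) (y : Fin d → ℤ) (a : ℤ) :
    coordNeg μ (y + axisVec μ a) = coordNeg μ y - axisVec μ a := by
  funext j
  simp only [coordNeg, axisVec, Pi.add_apply, Pi.sub_apply]
  by_cases hj : j = μ
  · subst hj
    simp; ring
  · simp [hj]

/-- `y - a e_ν = y + (-a) e_ν`. [folklore] -/
theorem sub_axisVec_eq_add (y : Fin d → ℤ) (ν : Fin d) (a : ℤ) :
    y - axisVec ν a = y + axisVec ν (-a) := by
  funext j
  simp only [Pi.sub_apply, Pi.add_apply, axisVec]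
  split_ifs <;> ring

/-- **Sign symmetry**: `p_i` is invariant under `y_μ ↦ -y_μ` (by induction on `i` from the
recursion; no change of variables). [folklore] -/
theorem srwP_coordNeg (μ : Fin d) : ∀ (i : ℕ) (y : Fin d → ℤ),
    srwP d i (coordNeg μ y) = srwP d i y := by
  intro i
  induction i with
  | zero =>
    intro y
    rw [srwP_zero, srwP_zero]
    simp only [coordNeg_eq_zero_iff]
  | succ i ih =>
    intro y
    rw [srwP_succ, srwP_succ]
    congr 1
    apply Finset.sum_congr rfl
    intro ν _
    by_cases hν : ν = μ
    · rw [hν, sub_axisVec_eq_add (coordNeg μ y), sub_axisVec_eq_add y]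
      rw [show coordNeg μ y + axisVec μ 1 = coordNeg μ (y + axisVec μ (-1)) by
            rw [coordNeg_add_axisVec_self, sub_axisVec_eq_add, neg_neg],
          show coordNeg μ y + axisVec μ (-1) = coordNeg μ (y + axisVec μ 1) by
            rw [coordNeg_add_axisVec_self, sub_axisVec_eq_add],
          ih, ih, add_comm]
    · rw [sub_axisVec_eq_add (coordNeg μ y), sub_axisVec_eq_add y,
        ← coordNeg_add_axisVec_ne hν, ← coordNeg_add_axisVec_ne hν, ih, ih]

/-! ### The reflection inequality (M4) -/

/-- **(M4)** `p_i(x + e_μ) ≤ p_i(x - e_μ)` whenever `x_μ ≥ 0` — the site one step further from the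
hyperplane `{y_μ = 0}` is less likely.  Induction on `i` from the recursion: the `ν ≠ μ` terms by the
induction hypothesis at `x ± e_ν`, the `ν = μ` terms reduce to `p_i(x + 2e_μ) ≤ p_i(x - 2e_μ)`, which
is two applications of the hypothesis if `x_μ ≥ 1` and an equality by sign symmetry if `x_μ = 0`.
(carver-g6 LEMMA-M.md (M4); tail-g2 KSUP.md §9.1a.) [folklore] -/
theorem srwP_step_le (μ : Fin d) : ∀ (i : ℕ) (x : Fin d → ℤ), 0 ≤ x μ →
    srwP d i (x + axisVec μ 1) ≤ srwP d i (x - axisVec μ 1) := by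
  intro i
  induction i with
  | zero =>
    intro x hx
    rw [srwP_zero, srwP_zero]
    have h1 : x + axisVec μ 1 ≠ 0 := by
      intro h
      have := congr_fun h μ
      simp [axisVec] at this
      omega
    rw [if_neg h1]
    split_ifs <;> norm_num
  | succ i ih =>
    intro x hx
    rw [srwP_succ, srwP_succ]
    apply div_le_div_of_nonneg_right _ (by positivity)
    apply Finset.sum_le_sum
    intro ν _
    by_cases hν : ν = μ
    · rw [hν, add_sub_cancel_right, sub_add_cancel]
      have key : srwP d i (x + axisVec μ 1 + axisVec μ 1) ≤ srwP d i (x - axisVec μ 1 - axisVec μ 1) := by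
        rcases (show x μ = 0 ∨ 1 ≤ x μ by omega) with h0 | h1
        · -- equality by the sign symmetry
          have e : coordNeg μ (x + axisVec μ 1 + axisVec μ 1) = x - axisVec μ 1 - axisVec μ 1 := by
            funext j
            simp only [coordNeg, axisVec, Pi.add_apply, Pi.sub_apply]
            by_cases hj : j = μ
            · subst hj; simp [h0]
            · simp [hj]
          rw [← e, srwP_coordNeg]
        · have h2 := ih (x + axisVec μ 1) (by simp [axisVec]; omega)
          have h3 := ih (x - axisVec μ 1) (by simp [axisVec]; omega)
          rw [add_sub_cancel_right] at h2
          rw [sub_add_cancel] at h3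
          exact h2.trans h3
      linarith
    · have hxν : 0 ≤ (x + axisVec ν 1) μ := by simp [axisVec, Ne.symm hν]; exact hx
      have hxν' : 0 ≤ (x - axisVec ν 1) μ := by simp [axisVec, Ne.symm hν]; exact hx
      have h2 := ih (x + axisVec ν 1) hxν
      have h3 := ih (x - axisVec ν 1) hxν'
      rw [add_right_comm x (axisVec μ 1), sub_add_eq_add_sub x (axisVec μ 1),
        add_sub_right_comm x (axisVec μ 1), sub_right_comm x (axisVec μ 1)]
      exact add_le_add h2 h3

/-- **PCM step for `p_i`**: `p_i(y + 2e_μ) ≤ p_i(y)` whenever `y_μ ≥ -1`.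
(tail-g2 KSUP.md §9.1a.) [folklore] -/
theorem srwP_parity_step (μ : Fin d) (i : ℕ) (y : Fin d → ℤ) (hy : -1 ≤ y μ) :
    srwP d i (y + axisVec μ 2) ≤ srwP d i y := by
  have h := srwP_step_le μ i (y + axisVec μ 1) (by simp [axisVec]; omega)
  have e1 : y + axisVec μ 1 + axisVec μ 1 = y + axisVec μ 2 := by
    funext j; simp only [Pi.add_apply, axisVec]; split_ifs <;> ring
  rwa [e1, add_sub_cancel_right] at h

/-! ### From steps and reflections to parity-class monotonicity -/

/-- If `f` is invariant under every `coordNeg μ`, then `f z = f z'` whenever `|z_μ| = |z'_μ|` for all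
`μ`. [folklore] -/
theorem eq_of_abs_eq_of_reflect (f : (Fin d → ℤ) → ℝ)
    (hrefl : ∀ (μ : Fin d) (y : Fin d → ℤ), f (coordNeg μ y) = f y) :
    ∀ (s : Finset (Fin d)) (z z' : Fin d → ℤ), (∀ μ, μ ∉ s → z μ = z' μ) →
      (∀ μ, |z μ| = |z' μ|) → f z = f z' := by
  intro s
  induction s using Finset.induction with
  | empty =>
    intro z z' hs _
    have : z = z' := funext fun μ => hs μ (by simp)
    rw [this]
  | @insert a s ha ih =>
    intro z z' hs habs
    by_cases hza : z a = z' a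
    · exact ih z z' (fun μ hμ => by
        by_cases hμa : μ = a
        · subst hμa; exact hza
        · exact hs μ (by simp [hμa, hμ])) habs
    · have hza' : z' a = -z a := by
        have := habs a
        rcases abs_eq_abs.mp this with h | h
        · exact absurd h hza
        · linarith
      rw [← hrefl a z]
      refine ih (coordNeg a z) z' (fun μ hμ => ?_) (fun μ => ?_)
      · by_cases hμa : μ = a
        · subst hμa; simp [coordNeg, hza']
        · simp only [coordNeg, if_neg hμa]; exact hs μ (by simp [hμa, hμ])
      · by_cases hμa : μ = a
        · subst hμa; simp [coordNeg, habs μ]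
        · simp only [coordNeg, if_neg hμa]; exact habs μ

/-- **Steps + reflections ⇒ PCM.**  If `f (y + 2e_μ) ≤ f y` whenever `y_μ ≥ -1` and `f` is invariant
under each sign change `y_μ ↦ -y_μ`, then `f` is parity-class monotone: `f z ≤ f z'` whenever
`|z'_μ| ≤ |z_μ|` and `z_μ ≡ z'_μ (mod 2)` for all `μ`. [folklore] -/
theorem parityMonotone_of_step_reflect (f : (Fin d → ℤ) → ℝ)
    (hstep : ∀ (μ : Fin d) (y : Fin d → ℤ), -1 ≤ y μ → f (y + axisVec μ 2) ≤ f y)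
    (hrefl : ∀ (μ : Fin d) (y : Fin d → ℤ), f (coordNeg μ y) = f y) :
    ParityMonotone f := by
  -- the mirrored step
  have hstep' : ∀ (μ : Fin d) (y : Fin d → ℤ), y μ ≤ 1 → f (y - axisVec μ 2) ≤ f y := by
    intro μ y hy
    have e : coordNeg μ (y - axisVec μ 2) = coordNeg μ y + axisVec μ 2 := by
      rw [sub_axisVec_eq_add, coordNeg_add_axisVec_self, sub_axisVec_eq_add, neg_neg]
    rw [← hrefl μ (y - axisVec μ 2), e, ← hrefl μ y]
    exact hstep μ (coordNeg μ y) (by simp [coordNeg]; omega)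
  -- induction on the total excess `Σ_μ (|z_μ| - |z'_μ|)`
  suffices H : ∀ (n : ℕ) (z z' : Fin d → ℤ), (∀ μ, |z' μ| ≤ |z μ| ∧ (z μ - z' μ) % 2 = 0) →
      ∑ μ, (|z μ| - |z' μ|) ≤ 2 * n → f z ≤ f z' by
    intro z z' h
    obtain ⟨n, hn⟩ : ∃ n : ℕ, ∑ μ, (|z μ| - |z' μ|) ≤ 2 * n := by
      refine ⟨(∑ μ, (|z μ| - |z' μ|)).toNat, ?_⟩
      have h1 := Int.self_le_toNat (∑ μ, (|z μ| - |z' μ|))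
      have h2 : (0 : ℤ) ≤ ((∑ μ, (|z μ| - |z' μ|)).toNat : ℤ) := by positivity
      linarith
    exact H n z z' h hn
  intro n
  induction n with
  | zero =>
    intro z z' h hsum
    have hnn : ∀ μ ∈ (Finset.univ : Finset (Fin d)), 0 ≤ |z μ| - |z' μ| :=
      fun μ _ => sub_nonneg.mpr (h μ).1
    have h0 : ∑ μ, (|z μ| - |z' μ|) = 0 :=
      le_antisymm (by simpa using hsum) (Finset.sum_nonneg hnn)
    have habs : ∀ μ, |z μ| = |z' μ| := fun μ => by
      have := (Finset.sum_eq_zero_iff_of_nonneg hnn).mp h0 μ (Finset.mem_univ μ)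
      linarith
    exact (eq_of_abs_eq_of_reflect f hrefl Finset.univ z z' (fun μ hμ => absurd (Finset.mem_univ μ) hμ)
      habs).le
  | succ n ih =>
    intro z z' h hsum
    by_cases hall : ∀ μ, |z μ| ≤ |z' μ|
    · -- no excess at all: equality case
      have habs : ∀ μ, |z μ| = |z' μ| := fun μ => le_antisymm (hall μ) (h μ).1
      exact (eq_of_abs_eq_of_reflect f hrefl Finset.univ z z'
        (fun μ hμ => absurd (Finset.mem_univ μ) hμ) habs).le
    · push Not at hall
      obtain ⟨μ, hμ⟩ := hall
      have hpar := (h μ).2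
      have hle := (h μ).1
      -- the excess at `μ` is even, hence at least 2
      have h2 : |z' μ| + 2 ≤ |z μ| := by
        simp only [Int.abs_eq_natAbs] at hμ hle ⊢
        omega
      -- move `z_μ` two units towards zero
      set z₁ : Fin d → ℤ := if 0 < z μ then z - axisVec μ 2 else z + axisVec μ 2 with hz₁
      have hz₁μ : |z₁ μ| = |z μ| - 2 ∧ (z₁ μ - z' μ) % 2 = 0 := by
        simp only [hz₁]
        split_ifs with hpos
        · simp only [Pi.sub_apply, axisVec, if_true, Int.abs_eq_natAbs] at hle h2 ⊢
          constructor <;> omega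
        · simp only [Pi.add_apply, axisVec, if_true, Int.abs_eq_natAbs] at hle h2 ⊢
          constructor <;> omega
      have hz₁ν : ∀ ν, ν ≠ μ → z₁ ν = z ν := by
        intro ν hν
        simp only [hz₁]
        split_ifs <;> simp [axisVec, hν]
      -- `f z ≤ f z₁`
      have hfz : f z ≤ f z₁ := by
        simp only [hz₁]
        split_ifs with hpos
        · have e : z = (z - axisVec μ 2) + axisVec μ 2 := (sub_add_cancel z _).symm
          have := hstep μ (z - axisVec μ 2) (by
            simp only [Pi.sub_apply, axisVec, if_true, Int.abs_eq_natAbs] at h2 ⊢; omega)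
          rw [← e] at this
          exact this
        · have e : z = (z + axisVec μ 2) - axisVec μ 2 := (add_sub_cancel_right z _).symm
          have := hstep' μ (z + axisVec μ 2) (by
            simp only [Pi.add_apply, axisVec, if_true, Int.abs_eq_natAbs] at h2 hle ⊢; omega)
          rw [← e] at this
          exact this
      -- `z₁` still dominates `z'`, with excess reduced by 2
      have h₁ : ∀ ν, |z' ν| ≤ |z₁ ν| ∧ (z₁ ν - z' ν) % 2 = 0 := by
        intro ν
        by_cases hν : ν = μ
        · subst hν
          exact ⟨by linarith [hz₁μ.1], hz₁μ.2⟩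
        · rw [hz₁ν ν hν]; exact h ν
      have hsum₁ : ∑ ν, (|z₁ ν| - |z' ν|) ≤ 2 * (n : ℤ) := by
        have hsplit : ∑ ν, (|z₁ ν| - |z' ν|) = ∑ ν, (|z ν| - |z' ν|) - 2 := by
          rw [← Finset.sum_erase_add _ _ (Finset.mem_univ μ),
            ← Finset.sum_erase_add (Finset.univ) (fun ν => |z ν| - |z' ν|) (Finset.mem_univ μ)]
          rw [Finset.sum_congr rfl (fun ν hν => by
            rw [hz₁ν ν (Finset.ne_of_mem_erase hν)] :
              ∀ ν ∈ Finset.univ.erase μ, |z₁ ν| - |z' ν| = |z ν| - |z' ν|)]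
          rw [hz₁μ.1]
          ring
        rw [hsplit]
        push_cast at hsum ⊢
        linarith
      exact hfz.trans (ih z₁ z' h₁ hsum₁)

/-- **PCM for the transition function**: every `p_i` is parity-class monotone.
(tail-g2 KSUP.md §9.1; = carver-g6 (M4) iterated.) [folklore] -/
theorem parityMonotone_srwP (i : ℕ) : ParityMonotone (srwP d i) :=
  parityMonotone_of_step_reflect _ (fun μ y hy => srwP_parity_step μ i y hy)
    (fun μ y => srwP_coordNeg μ i y)

end Literature.Probability.FitznerVanDerHofstad2017
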